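import Mathlib.NumberTheory.NumberField.CMField
import Mathlib.FieldTheory.LinearDisjoint
import Literature.NumberTheory.GaloisRepresentations.SolvableTowerEngine
import Literature.NumberTheory.GaloisRepresentations.LocalConditionPushdown
import HarnessLib

/-!
# Assembly of Clozel–Harris–Taylor, Lemma 4.1.2 (CM form) from the solvable tower engine

Topic `NumberTheory/NumberFields`; theorems only (no definition, no named fact).  For a CM number
field `F` with maximal totally real subfield `F⁺`, a finite extension `D/F`, a finite set `S` of
finite places of `F` and open subgroups `U_v ≤ Γ_{F_v}`, we produce a finite Galois extension
`L/F` with solvable Galois group, CM, linearly disjoint from `D` (`D ⊗_F L` a field), such that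
for `v ∈ S` and every place `w ∣ v` of `L` the restriction of every element of `Γ_{L_w}` to
`Γ_{F_v}` lies in `U_v` (`exists_solvable_cm_extension_local_of`).  `L = E · F` inside
`\overline{F⁺}`, where `E/F⁺` is the totally real solvable Galois extension produced by
`exists_isSolvable_forall_localGroup_le` over `K = F⁺` for: the places `S⁺` of `F⁺` below `S`
with the open normal subgroups `N_{v⁺} = ⋂_{v ∣ v⁺} N_v`, `res⁻¹(N_v) ⊆ U_v`
(`exists_openNormal_forall_absGaloisRestrict_mem`), and an auxiliary finite set `V` of places of
`F⁺` whose local Galois groups meet, up to conjugacy, every coset of `Gal(\overline{F⁺}/D̃)`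
(`D̃` a Galois closure of `D` over `F⁺`; `exists_conj_absGaloisRestrict_mul_inv_mem`), which
forces `E F ∩ D̃ = F` and hence the linear disjointness (Mathlib
`IntermediateField.LinearDisjoint.of_inf_eq_bot`, `isField_of_isAlgebraic'`).

## References

* L. Clozel, M. Harris, R. Taylor, Publ. Math. IHÉS 108 (2008), Lemma 4.1.2 (p. 116) and proof
  of Thm. 4.4.2 (pp. 130–131). [cite: ClozelHarrisTaylor2008, Lemma 4.1.2]
* J. Neukirch, *Algebraic Number Theory*, Ch. II §9 (9.6), Ch. VI §1. [NeukirchANT1999]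
-/

noncomputable section

open scoped NumberField IntermediateField Valued TensorProduct Pointwise
open Field IsDedekindDomain IntermediateField NumberField
open Literature.NumberTheory.GaloisRepresentations Literature.NumberTheory.Automorphic
open Literature.FieldTheory.Galois

namespace Literature.NumberTheory.NumberFields

/-! ### Field-theoretic part: `L = E · F` -/

/-- **`L = E·F` is finite Galois over `F` with solvable group, CM, a number field**, for
`E ⊆ \overline{F⁺}` finite Galois solvable totally real over `F⁺` and `F ↪ \overline{F⁺}` CM.
[cite: ClozelHarrisTaylor2008, proof of Thm. 4.4.2 (pp. 130–131)] -/
theorem exists_cm_compositum (K₀ F : Type) [Field K₀] [NumberField K₀] [IsTotallyReal K₀]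
    [Field F] [NumberField F] [Algebra K₀ F] [IsTotallyComplex F]
    [Algebra.IsQuadraticExtension K₀ F]
    (E : IntermediateField K₀ (AlgebraicClosure K₀)) [FiniteDimensional K₀ E] [IsGalois K₀ E]
    (hsolv : IsSolvable (E ≃ₐ[K₀] E))
    (hTR : ∀ φ : E →+* ℂ, ComplexEmbedding.IsReal φ) (f : F →ₐ[K₀] AlgebraicClosure K₀) :
    ∃ (L : IntermediateField (↥E) (AlgebraicClosure K₀)) (i : F →+* L),
      L.restrictScalars K₀ = E ⊔ f.fieldRange ∧
      (∀ x : F, ((i x : L) : AlgebraicClosure K₀) = f x) ∧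
      letI := i.toAlgebra
      IsScalarTower K₀ F L ∧ NumberField L ∧ FiniteDimensional F L ∧
      IsGalois F L ∧ IsSolvable (L ≃ₐ[F] L) ∧ IsCMField L := by
  classical
  haveI : NumberField E := NumberField.of_module_finite K₀ E
  -- the image `F''` of `F`, quadratic Galois over `K₀`
  set F'' : IntermediateField K₀ (AlgebraicClosure K₀) := f.fieldRange with hF''
  have hfin2 : Module.finrank K₀ F'' = 2 := by
    rw [← Algebra.IsQuadraticExtension.finrank_eq_two K₀ F]
    exact ((AlgEquiv.ofInjectiveField f).toLinearEquiv.finrank_eq).symm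
  haveI : FiniteDimensional K₀ F'' := Module.finite_of_finrank_pos (by rw [hfin2]; exact two_pos)
  haveI : Algebra.IsSeparable K₀ F'' := Algebra.IsAlgebraic.isSeparable_of_perfectField
  haveI : IsSolvable (E ≃ₐ[K₀] E) := hsolv
  obtain ⟨_, hgal, hsol⟩ := isGalois_and_isSolvable_sup_of_finrank_le_two E F'' hfin2.le
  -- `L = E ⊔ F''` over `E`
  set L : IntermediateField (↥E) (AlgebraicClosure K₀) :=
    extendScalars (le_sup_left : E ≤ E ⊔ F'') with hLdef
  have hL : L.restrictScalars K₀ = E ⊔ F'' := rfl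
  have hmemL : ∀ x : F, f x ∈ L := fun x =>
    (le_sup_right : F'' ≤ E ⊔ F'') (AlgHom.mem_fieldRange.2 ⟨x, rfl⟩)
  set i : F →+* L := (f : F →+* AlgebraicClosure K₀).codRestrict L hmemL with hidef
  have hi : ∀ x : F, ((i x : L) : AlgebraicClosure K₀) = f x := fun x => rfl
  letI := i.toAlgebra
  have hST : IsScalarTower K₀ F L :=
    IsScalarTower.of_algebraMap_eq fun c => Subtype.ext (f.commutes c).symm
  haveI := hST
  haveI hLfin : FiniteDimensional K₀ L :=
    (inferInstance : FiniteDimensional K₀ (E ⊔ F'' : IntermediateField K₀ (AlgebraicClosure K₀)))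
  haveI hLnf : NumberField L := NumberField.of_module_finite K₀ L
  have hLfinF : FiniteDimensional F L := Module.Finite.of_restrictScalars_finite K₀ F L
  haveI hLgal : IsGalois K₀ L := hgal
  have hLsol : IsSolvable (L ≃ₐ[K₀] L) := hsol
  -- over `F`
  have hgalF : IsGalois F L := IsGalois.tower_top_of_isGalois K₀ F L
  have hsolF : IsSolvable (L ≃ₐ[F] L) := by
    haveI := hLsol
    let r : (L ≃ₐ[F] L) →* (L ≃ₐ[K₀] L) :=
      { toFun := fun φ => φ.restrictScalars K₀
        map_one' := by ext; rfl
        map_mul' := fun _ _ => by ext; rfl }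
    exact solvable_of_solvable_injective (f := r) (AlgEquiv.restrictScalars_injective K₀)
  -- CM
  haveI : IsTotallyReal E := ⟨fun w => InfinitePlace.isReal_iff.2 (hTR w.embedding)⟩
  haveI : IsTotallyComplex L := isTotallyComplex_of_algebra F L
  have hle2 : Module.finrank (↥E) L ≤ 2 := by
    have h1 := Module.finrank_mul_finrank K₀ (↥E) L
    have h2 : Module.finrank K₀ L ≤ Module.finrank K₀ E * Module.finrank K₀ F'' :=
      IntermediateField.finrank_sup_le E F''
    rw [hfin2, ← h1] at h2
    exact Nat.le_of_mul_le_mul_left h2 Module.finrank_pos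
  have hne1 : Module.finrank (↥E) L ≠ 1 := by
    intro h1
    rw [IntermediateField.finrank_eq_one_iff] at h1
    have hF''E : F'' ≤ E := by
      have h2 : E ⊔ F'' = E := by
        rw [← hL, h1, IntermediateField.restrictScalars_bot_eq_self]
      exact h2 ▸ le_sup_right
    -- an embedding of `F` through `E` would be real
    obtain ⟨ψ⟩ : Nonempty (E →+* ℂ) := ⟨(Classical.arbitrary (InfinitePlace E)).embedding⟩
    let j : F →+* E := (f : F →+* AlgebraicClosure K₀).codRestrict E fun x =>
      hF''E (AlgHom.mem_fieldRange.2 ⟨x, rfl⟩)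
    have hreal : ComplexEmbedding.IsReal (ψ.comp j) := by
      rw [ComplexEmbedding.isReal_iff]
      ext x
      have h := hTR ψ
      rw [ComplexEmbedding.isReal_iff] at h
      exact RingHom.congr_fun h (j x)
    exact IsTotallyComplex.complexEmbedding_not_isReal (ψ.comp j) hreal
  haveI : Module.Free (↥E) L := Module.Free.of_divisionRing (↥E) L
  haveI : Algebra.IsQuadraticExtension (↥E) L :=
    { finrank_eq_two' := by have := Module.finrank_pos (R := ↥E) (M := L); omega }
  have hCM : IsCMField L := IsCMField.ofCMExtension (↥E) L
  exact ⟨L, i, hL, hi, hST, hLnf, hLfinF, hgalF, hsolF, hCM⟩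

/-! ### Galois-theoretic helpers inside `\overline{K}` -/

/-- An element of `K̄` fixed by every `g ∈ Γ_K` fixing the finite extension `F'' ⊆ K̄` lies in
`F''` (Galois correspondence). [folklore] -/
theorem mem_of_forall_smul_eq {K : Type} [Field K] [NumberField K]
    (F'' : IntermediateField K (AlgebraicClosure K)) [FiniteDimensional K F'']
    {x : AlgebraicClosure K}
    (h : ∀ g : absoluteGaloisGroup K, (∀ y ∈ F'', g • y = y) → g • x = x) : x ∈ F'' := by
  have h1 : x ∈ IntermediateField.fixedField F''.fixingSubgroup := by
    rw [IntermediateField.mem_fixedField_iff]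
    intro τ hτ
    rw [IntermediateField.mem_fixingSubgroup_iff] at hτ
    exact h ((absoluteGaloisGroup.toAlgEquiv K).symm τ) hτ
  rwa [InfiniteGalois.fixedField_fixingSubgroup] at h1

/-- `g` fixing `E` and `F''` pointwise fixes `E ⊔ F''` pointwise. [folklore] -/
theorem forall_mem_sup_smul_eq {K : Type} [Field K] (E F'' : IntermediateField K (AlgebraicClosure K))
    (g : absoluteGaloisGroup K) (hE : ∀ y ∈ E, g • y = y) (hF : ∀ y ∈ F'', g • y = y) :
    ∀ y ∈ E ⊔ F'', g • y = y := by
  intro y hy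
  rw [← (IntermediateField.gi (F := K) (E := AlgebraicClosure K)).l_sup_u] at hy
  change y ∈ IntermediateField.adjoin K ((E : Set (AlgebraicClosure K)) ∪ F'') at hy
  induction hy using IntermediateField.adjoin_induction with
  | mem z hz =>
      rcases hz with hz | hz
      · exact hE z hz
      · exact hF z hz
  | algebraMap c => rw [absoluteGaloisGroup.smul_def, AlgEquiv.commutes]
  | add x y _ _ hx hy => rw [smul_add, hx, hy]
  | inv x _ hx => rw [smul_inv'', hx]
  | mul x y _ _ hx hy => rw [smul_mul', hx, hy]

/-- The pointwise stabiliser of a normal subextension is normalised by `Γ_K`. [folklore] -/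
theorem conj_smul_eq_of_normal {K : Type} [Field K] [NumberField K]
    (E : IntermediateField K (AlgebraicClosure K))
    [Normal K E] {a : absoluteGaloisGroup K} (ha : ∀ y ∈ E, a • y = y) (g : absoluteGaloisGroup K) :
    ∀ y ∈ E, (g * a * g⁻¹) • y = y := by
  intro y hy
  rw [mul_smul, mul_smul,
    ha _ (Literature.NumberTheory.GaloisRepresentations.smul_mem_of_normal E g⁻¹ hy), smul_inv_smul]

/-! ### The local computation along `K_u → F_v → L_w` -/

set_option maxHeartbeats 400000 in
/-- **`res(res τ)` fixes `ι_u E`.**  For number fields `K ⊆ F ⊆ L`, a finite normal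
subextension `E ⊆ K̄` of `K` with a `K`-embedding `E → L`, places `w ∣ v ∣ u` and the local
base-change algebras `K_u → F_v → L_w` (`adicCompletionOfLiesOver`), every `τ ∈ Γ_{L_w}`
restricted to `Γ_{K_u}` fixes `ι_u E`: the composite embedding `K̄ → \bar K_u → \bar F_v → \bar L_w`
maps `E` onto the same set as `E → L → L_w → \bar L_w` (both are `K`-embeddings of the normal
extension `E/K`), which `τ` fixes. [cite: NeukirchANT1999, Ch. II §9 Prop. (9.6)] -/
theorem smul_absClosureEmbedding_eq_of_tower {K F L : Type} [Field K] [NumberField K]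
    [Field F] [NumberField F] [Field L] [NumberField L] [Algebra K F] [Algebra F L] [Algebra K L]
    [IsScalarTower K F L] (E : IntermediateField K (AlgebraicClosure K)) [FiniteDimensional K E]
    [Normal K E] (ιE : E →ₐ[K] L) (u : HeightOneSpectrum (𝓞 K)) (v : HeightOneSpectrum (𝓞 F))
    (w : HeightOneSpectrum (𝓞 L)) [v.asIdeal.LiesOver u.asIdeal] [w.asIdeal.LiesOver v.asIdeal] :
    letI := (adicCompletionOfLiesOver K F u v).toAlgebra
    letI := (adicCompletionOfLiesOver F L v w).toAlgebra
    ∀ (τ : absoluteGaloisGroup (w.adicCompletion L)) (x : AlgebraicClosure K), x ∈ E →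
      absGaloisRestrict (u.adicCompletion K) (v.adicCompletion F)
          (absGaloisRestrict (v.adicCompletion F) (w.adicCompletion L) τ) •
        absClosureEmbedding K (u.adicCompletion K) x =
      absClosureEmbedding K (u.adicCompletion K) x := by
  letI i₁ := (adicCompletionOfLiesOver K F u v).toAlgebra
  letI i₂ := (adicCompletionOfLiesOver F L v w).toAlgebra
  intro τ x hx
  -- scalar towers for the restriction of scalars of the embeddings of algebraic closures
  haveI hT₁ : IsScalarTower K (u.adicCompletion K) (AlgebraicClosure (v.adicCompletion F)) := by
    refine IsScalarTower.of_algebraMap_eq fun c => ?_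
    rw [IsScalarTower.algebraMap_apply K (v.adicCompletion F) (AlgebraicClosure (v.adicCompletion F)),
      IsScalarTower.algebraMap_apply (u.adicCompletion K) (v.adicCompletion F)
        (AlgebraicClosure (v.adicCompletion F))]
    congr 1
    rw [RingHom.algebraMap_toAlgebra, IsScalarTower.algebraMap_apply K F (v.adicCompletion F)]
    change ((algebraMap F (v.adicCompletion F)) (algebraMap K F c)) =
      adicCompletionOfLiesOver K F u v ((c : K) : u.adicCompletion K)
    rw [adicCompletionOfLiesOver_coe]
    rfl
  haveI hT₂ : IsScalarTower K (v.adicCompletion F) (AlgebraicClosure (w.adicCompletion L)) := by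
    refine IsScalarTower.of_algebraMap_eq fun c => ?_
    rw [IsScalarTower.algebraMap_apply K (w.adicCompletion L) (AlgebraicClosure (w.adicCompletion L)),
      IsScalarTower.algebraMap_apply (v.adicCompletion F) (w.adicCompletion L)
        (AlgebraicClosure (w.adicCompletion L))]
    congr 1
    rw [RingHom.algebraMap_toAlgebra, IsScalarTower.algebraMap_apply K F (v.adicCompletion F),
      IsScalarTower.algebraMap_apply K L (w.adicCompletion L)]
    change ((algebraMap L (w.adicCompletion L)) (algebraMap K L c)) =
      adicCompletionOfLiesOver F L v w ((algebraMap K F c : F) : v.adicCompletion F)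
    rw [adicCompletionOfLiesOver_coe, ← IsScalarTower.algebraMap_apply K F L]
    rfl
  -- the two `K`-embeddings `E → \bar L_w`
  set J : ↥E →ₐ[K] AlgebraicClosure (w.adicCompletion L) :=
    (((absClosureEmbedding (v.adicCompletion F) (w.adicCompletion L)).restrictScalars K).comp
      (((absClosureEmbedding (u.adicCompletion K) (v.adicCompletion F)).restrictScalars K).comp
        (absClosureEmbedding K (u.adicCompletion K)))).comp E.val with hJdef
  have hJ : ∀ z : ↥E, J z = absClosureEmbedding (v.adicCompletion F) (w.adicCompletion L)
      (absClosureEmbedding (u.adicCompletion K) (v.adicCompletion F)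
        (absClosureEmbedding K (u.adicCompletion K) (z : AlgebraicClosure K))) := fun z => rfl
  set e : ↥E →ₐ[K] AlgebraicClosure (w.adicCompletion L) :=
    (IsScalarTower.toAlgHom K L (AlgebraicClosure (w.adicCompletion L))).comp ιE with hedef
  have he : ∀ z : ↥E, e z = algebraMap (w.adicCompletion L) (AlgebraicClosure (w.adicCompletion L))
      (algebraMap L (w.adicCompletion L) (ιE z)) := fun z =>
    IsScalarTower.algebraMap_apply L (w.adicCompletion L) (AlgebraicClosure (w.adicCompletion L)) _
  -- `J z` is a root of `minpoly K z`, hence in the image of `e`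
  set z : ↥E := ⟨x, hx⟩ with hzdef
  have hint : IsIntegral K z := Algebra.IsIntegral.isIntegral z
  have hsplit : ((minpoly K z).map (algebraMap K ↥E)).Splits := Normal.splits inferInstance z
  have hroot : J z ∈ (minpoly K z).rootSet (AlgebraicClosure (w.adicCompletion L)) := by
    rw [Polynomial.mem_rootSet]
    exact ⟨minpoly.ne_zero hint, by rw [Polynomial.aeval_algHom_apply, minpoly.aeval, map_zero]⟩
  rw [← hsplit.image_rootSet e] at hroot
  obtain ⟨z', -, hz'⟩ := hroot
  -- conclude
  have hfix : τ • J z = J z := by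
    rw [← hz', he, absoluteGaloisGroup.smul_def, AlgEquiv.commutes]
  rw [hJ] at hfix
  have h1 : absClosureEmbedding (v.adicCompletion F) (w.adicCompletion L)
      (absClosureEmbedding (u.adicCompletion K) (v.adicCompletion F)
        (absGaloisRestrict (u.adicCompletion K) (v.adicCompletion F)
          (absGaloisRestrict (v.adicCompletion F) (w.adicCompletion L) τ) •
            absClosureEmbedding K (u.adicCompletion K) x)) =
      absClosureEmbedding (v.adicCompletion F) (w.adicCompletion L)
        (absClosureEmbedding (u.adicCompletion K) (v.adicCompletion F)
          (absClosureEmbedding K (u.adicCompletion K) x)) := by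
    rw [absGaloisRestrict_apply_smul, absGaloisRestrict_apply_smul]
    exact hfix
  exact (absClosureEmbedding (u.adicCompletion K) (v.adicCompletion F)).injective
    ((absClosureEmbedding (v.adicCompletion F) (w.adicCompletion L)).injective h1)

/-! ### The assembly -/

set_option maxHeartbeats 1600000 in
/-- **Clozel–Harris–Taylor, Lemma 4.1.2, CM form with local containment** — assembled from the
solvable tower engine over `F⁺`.  See the module docstring.
[cite: ClozelHarrisTaylor2008, Lemma 4.1.2 (p. 116) and proof of Thm. 4.4.2 (pp. 130–131)] -/
theorem exists_solvable_cm_extension_local_of (F : Type) [Field F] [NumberField F]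
    (hCM : IsCMField F) (D : Type) [Field D] [Algebra F D] (hD : FiniteDimensional F D)
    (S : Finset (HeightOneSpectrum (𝓞 F)))
    (U : (v : HeightOneSpectrum (𝓞 F)) → OpenSubgroup (absoluteGaloisGroup (v.adicCompletion F))) :
    ∃ (L : Type) (_ : Field L) (_ : NumberField L) (_ : Algebra F L),
      IsGalois F L ∧ IsSolvable (L ≃ₐ[F] L) ∧ NumberField.IsCMField L ∧ IsField (D ⊗[F] L) ∧
      ∀ v ∈ S, ∀ (w : HeightOneSpectrum (𝓞 L)) (_ : w.asIdeal.LiesOver v.asIdeal),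
        letI := (adicCompletionOfLiesOver F L v w).toAlgebra
        ∀ τ : absoluteGaloisGroup (w.adicCompletion L),
          absGaloisRestrict (v.adicCompletion F) (w.adicCompletion L) τ ∈ U v := by
  classical
  haveI := hCM
  haveI := hD
  set Kp : Subfield F := maximalRealSubfield F with hKp
  -- `D ↪ \overline{F⁺}` over `F⁺`, and `F ↪ \overline{F⁺}` through `D`
  haveI : Module.Finite Kp D := Module.Finite.trans F D
  set fa' : D →ₐ[Kp] AlgebraicClosure Kp := IsAlgClosed.lift with hfa'def
  set f : F →ₐ[Kp] AlgebraicClosure Kp := fa'.comp (IsScalarTower.toAlgHom Kp F D) with hfdef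
  have hffa' : ∀ x : F, f x = fa' (algebraMap F D x) := fun x => rfl
  have hfin2 : Module.finrank Kp f.fieldRange = 2 := by
    rw [← Algebra.IsQuadraticExtension.finrank_eq_two Kp F]
    exact ((AlgEquiv.ofInjectiveField f).toLinearEquiv.finrank_eq).symm
  haveI : FiniteDimensional Kp f.fieldRange :=
    Module.finite_of_finrank_pos (by rw [hfin2]; exact two_pos)
  -- the Galois closure `Dt` of the image of `D` over `F⁺` and `C = Gal(\overline{F⁺}/Dt)`
  set Dp : IntermediateField Kp (AlgebraicClosure Kp) := fa'.fieldRange with hDp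
  haveI : FiniteDimensional Kp Dp :=
    LinearEquiv.finiteDimensional (AlgEquiv.ofInjectiveField fa').toLinearEquiv
  set Dt : IntermediateField Kp (AlgebraicClosure Kp) := normalClosure Kp Dp (AlgebraicClosure Kp)
    with hDt
  have hFDt : f.fieldRange ≤ Dt := by
    intro y hy
    obtain ⟨x, rfl⟩ := AlgHom.mem_fieldRange.1 hy
    exact IntermediateField.le_normalClosure Dp (AlgHom.mem_fieldRange.2 ⟨algebraMap F D x, rfl⟩)
  set C : Subgroup (absoluteGaloisGroup Kp) :=
    Dt.fixingSubgroup.comap (absoluteGaloisGroup.toAlgEquiv Kp).toMonoidHom with hCdef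
  have hC : ∀ g, g ∈ C ↔ ∀ y ∈ Dt, g • y = y := fun g => by
    rw [hCdef, Subgroup.mem_comap, MulEquiv.coe_toMonoidHom, IntermediateField.mem_fixingSubgroup_iff]
    rfl
  haveI hCn : C.Normal := Subgroup.Normal.comap inferInstance _
  have hCo : IsOpen (C : Set (absoluteGaloisGroup Kp)) := IntermediateField.fixingSubgroup_isOpen Dt
  have hCidx : C.index = Module.finrank Kp Dt := by
    rw [hCdef]
    exact (Subgroup.index_comap_of_surjective _ (absoluteGaloisGroup.toAlgEquiv Kp).surjective).trans
      (index_fixingSubgroup_eq_finrank Dt)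
  haveI : C.FiniteIndex := ⟨by rw [hCidx]; exact Module.finrank_pos.ne'⟩
  haveI : Finite (absoluteGaloisGroup Kp ⧸ C) := Subgroup.finite_quotient_of_finiteIndex
  letI : Fintype (absoluteGaloisGroup Kp ⧸ C) := Fintype.ofFinite _
  -- places of `F⁺` below `S` and the auxiliary set `V`
  set Sp : Finset (HeightOneSpectrum (𝓞 Kp)) := S.image fun v => v.under (𝓞 Kp) with hSp
  have hcheb : ∀ q : absoluteGaloisGroup Kp ⧸ C, ∃ u ∉ Sp,
      ∃ (σ : absoluteGaloisGroup (u.adicCompletion Kp)) (γ : absoluteGaloisGroup Kp),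
        γ⁻¹ * absGaloisRestrict Kp (u.adicCompletion Kp) σ * γ * q.out⁻¹ ∈ C := fun q =>
    exists_conj_absGaloisRestrict_mul_inv_mem C hCo q.out Sp
  choose uq huq σq γq hq using hcheb
  set V : Finset (HeightOneSpectrum (𝓞 Kp)) := Finset.univ.image uq with hV
  have hSV : Disjoint Sp V := by
    rw [Finset.disjoint_right]
    intro u hu
    obtain ⟨q, -, rfl⟩ := Finset.mem_image.1 hu
    exact huq q
  -- the open normal subgroups `N_u`
  have hN₀ : ∀ (u : HeightOneSpectrum (𝓞 Kp)) (v : HeightOneSpectrum (𝓞 F))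
      (h : v.asIdeal.LiesOver u.asIdeal),
      ∃ N₀ : Subgroup (absoluteGaloisGroup (u.adicCompletion Kp)), N₀.Normal ∧
        IsOpen (N₀ : Set (absoluteGaloisGroup (u.adicCompletion Kp))) ∧
        (letI := (adicCompletionOfLiesOver Kp F u v).toAlgebra
         ∀ a : absoluteGaloisGroup (v.adicCompletion F),
          absGaloisRestrict (u.adicCompletion Kp) (v.adicCompletion F) a ∈ N₀ → a ∈ U v) :=
    fun u v h => exists_openNormal_forall_absGaloisRestrict_mem u v (U v)
  choose N₀ hN₀n hN₀o hN₀U using hN₀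
  set N : (u : HeightOneSpectrum (𝓞 Kp)) → Subgroup (absoluteGaloisGroup (u.adicCompletion Kp)) :=
    fun u => ⨅ v ∈ S, ⨅ (h : v.asIdeal.LiesOver u.asIdeal), N₀ u v h with hNdef
  have hNle : ∀ u, ∀ v ∈ S, ∀ (h : v.asIdeal.LiesOver u.asIdeal), N u ≤ N₀ u v h :=
    fun u v hv h => (iInf_le _ v).trans ((iInf_le _ hv).trans (iInf_le _ h))
  have hNn : ∀ u ∈ Sp, (N u).Normal := fun u _ =>
    Subgroup.normal_iInf_normal fun v => Subgroup.normal_iInf_normal fun _ =>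
      Subgroup.normal_iInf_normal fun h => hN₀n u v h
  have hNo : ∀ u ∈ Sp, IsOpen (N u : Set (absoluteGaloisGroup (u.adicCompletion Kp))) := by
    intro u _
    have hset : (N u : Set (absoluteGaloisGroup (u.adicCompletion Kp))) =
        ⋂ v ∈ S, ⋂ (h : v.asIdeal.LiesOver u.asIdeal),
          (N₀ u v h : Set (absoluteGaloisGroup (u.adicCompletion Kp))) := by
      simp only [hNdef, Subgroup.coe_iInf]
    rw [hset]
    exact isOpen_biInter_finset fun v _ => isOpen_iInter_of_finite fun h => hN₀o u v h
  -- THE ENGINE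
  obtain ⟨E, hEfin, hEgal, hEsolv, hEloc, hEsplit, hETR⟩ :=
    exists_isSolvable_forall_localGroup_le (↥Kp) Sp N hNn hNo V hSV
  haveI := hEfin
  haveI := hEgal
  have hTR : ∀ φ : E →+* ℂ, ComplexEmbedding.IsReal φ :=
    hETR fun φ => IsTotallyReal.complexEmbedding_isReal φ
  -- `L = E · F`
  obtain ⟨L, i, hL, hi, hST, hLnf, hLfinF, hgalF, hsolF, hCM'⟩ :=
    exists_cm_compositum (↥Kp) F E hEsolv hTR f
  letI := i.toAlgebra
  haveI := hST
  haveI := hLnf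
  refine ⟨↥L, inferInstance, hLnf, i.toAlgebra, hgalF, hsolF, hCM', ?_, ?_⟩
  · -- linear disjointness from `D`: the `F`-algebra structure of `\overline{F⁺}` through `f`
    letI : Algebra F (AlgebraicClosure Kp) := (f : F →+* AlgebraicClosure Kp).toAlgebra
    let fa : D →ₐ[F] AlgebraicClosure Kp :=
      { (fa' : D →+* AlgebraicClosure Kp) with commutes' := fun x => (hffa' x).symm }
    have hfa : ∀ d : D, fa d = fa' d := fun d => rfl
    haveI : FiniteDimensional F fa.fieldRange :=
      LinearEquiv.finiteDimensional (AlgEquiv.ofInjectiveField fa).toLinearEquiv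
    haveI : FiniteDimensional F L := hLfinF
    let fb : L →ₐ[F] AlgebraicClosure Kp :=
      { (IntermediateField.val L : L →+* AlgebraicClosure Kp) with commutes' := fun x => hi x }
    have hfb : ∀ l : L, fb l = (l : AlgebraicClosure Kp) := fun l => rfl
    haveI : FiniteDimensional F fb.fieldRange :=
      LinearEquiv.finiteDimensional (AlgEquiv.ofInjectiveField fb).toLinearEquiv
    haveI : IsGalois F fb.fieldRange := IsGalois.of_algEquiv (AlgEquiv.ofInjectiveField fb)
    have key : fb.fieldRange ⊓ fa.fieldRange = ⊥ := by
      rw [eq_bot_iff]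
      rintro x ⟨hxL, hxD⟩
      obtain ⟨l, rfl⟩ := AlgHom.mem_fieldRange.1 hxL
      have hxEF : fb l ∈ E ⊔ f.fieldRange := by
        rw [← hL, hfb]
        exact l.2
      have hxDt : fb l ∈ Dt := by
        obtain ⟨d, hd⟩ := AlgHom.mem_fieldRange.1 hxD
        exact IntermediateField.le_normalClosure Dp (AlgHom.mem_fieldRange.2 ⟨d, hd⟩)
      have hCx : ∀ c ∈ C, c • fb l = fb l := fun c hc => (hC c).1 hc _ hxDt
      have hCB : ∀ c ∈ C, ∀ y ∈ f.fieldRange, c • y = y := fun c hc y hy => (hC c).1 hc y (hFDt hy)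
      have hxF : fb l ∈ f.fieldRange := by
        refine mem_of_forall_smul_eq f.fieldRange fun g hg => ?_
        obtain ⟨c₀, hc₀⟩ := QuotientGroup.mk_out_eq_mul C g
        have hn₀C := hq (QuotientGroup.mk g)
        rw [hc₀] at hn₀C
        have hrA : ∀ y ∈ E, absGaloisRestrict Kp _ (σq (QuotientGroup.mk g)) • y = y :=
          (forall_smul_absClosureEmbedding_eq_iff (↥Kp) (uq (QuotientGroup.mk g)) E
            (σq (QuotientGroup.mk g))).1
            (hEsplit (uq (QuotientGroup.mk g))
              (Finset.mem_image_of_mem _ (Finset.mem_univ _)) (σq (QuotientGroup.mk g)))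
        have hn₀A : ∀ y ∈ E, ((γq (QuotientGroup.mk g))⁻¹ *
            absGaloisRestrict Kp _ (σq (QuotientGroup.mk g)) * γq (QuotientGroup.mk g)) • y = y := by
          have h := conj_smul_eq_of_normal E hrA (γq (QuotientGroup.mk g))⁻¹
          simpa only [inv_inv] using h
        set n₀ := (γq (QuotientGroup.mk g))⁻¹ *
            absGaloisRestrict Kp _ (σq (QuotientGroup.mk g)) * γq (QuotientGroup.mk g) with hn₀
        have hn₀B : ∀ y ∈ f.fieldRange, n₀ • y = y := by
          intro y hy
          have h1 : n₀ = (n₀ * (g * c₀)⁻¹) * g * c₀ := by group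
          rw [h1, mul_smul, mul_smul, hCB _ c₀.2 y hy, hg y hy, hCB _ hn₀C y hy]
        have hn₀x : n₀ • fb l = fb l := forall_mem_sup_smul_eq E f.fieldRange n₀ hn₀A hn₀B _ hxEF
        have h2 : g = (n₀ * (g * c₀)⁻¹)⁻¹ * n₀ * (c₀ : absoluteGaloisGroup Kp)⁻¹ := by group
        rw [h2, mul_smul, mul_smul, hCx _ (C.inv_mem c₀.2), hn₀x, hCx _ (C.inv_mem hn₀C)]
      obtain ⟨c, hc⟩ := AlgHom.mem_fieldRange.1 hxF
      exact IntermediateField.mem_bot.2 ⟨c, hc⟩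
    have hLD : fa.fieldRange.LinearDisjoint fb.fieldRange :=
      (IntermediateField.LinearDisjoint.of_inf_eq_bot key).symm
    exact IntermediateField.LinearDisjoint.isField_of_isAlgebraic' hLD (Or.inl inferInstance)
  · -- the local containment
    intro v hv w hw τ
    have hu : v.under (𝓞 Kp) ∈ Sp := Finset.mem_image_of_mem _ hv
    haveI hvu : v.asIdeal.LiesOver (v.under (𝓞 Kp)).asIdeal := ⟨rfl⟩
    letI := (adicCompletionOfLiesOver (↥Kp) F (v.under (𝓞 Kp)) v).toAlgebra
    letI := (adicCompletionOfLiesOver F L v w).toAlgebra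
    refine hN₀U (v.under (𝓞 Kp)) v hvu _ (hNle _ v hv hvu ?_)
    refine hEloc _ hu _ fun x hx => ?_
    exact smul_absClosureEmbedding_eq_of_tower E (IsScalarTower.toAlgHom Kp E L)
      (v.under (𝓞 Kp)) v w τ x hx

end Literature.NumberTheory.NumberFields
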